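/-
O(2) `{φ, s, t}` scan: the LIGHT ROWS of the charged `2 × 2` sectors `2⁺` and `1` with CLOSED-FORM tables,
at a point and uniformly on a BOX of external dimensions.
-/
import Literature.MathematicalPhysics.QuantumFieldTheory.O2ChargedDimBox
import Literature.MathematicalPhysics.QuantumFieldTheory.O2LightDimBox
import Literature.MathematicalPhysics.QuantumFieldTheory.ConformalBootstrap3D.DoPochRatioCells
import HarnessLib

/-!
# O(2) `{φ, s, t}` scan: light rows of the sectors `2⁺` and `1` with closed-form tables

The cell rules `O2ChargedSectorsCells.pos2p_on_cell_Ico` and `pos1_on_cell_Ico` decide the `2 × 2`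
sectors `2⁺` and `1` on a half-open cell `Δ ∈ [a, b)` of the exchanged dimension from three TABLES per
head index `q = (n, j)` — lower tables for the two diagonal entries and an absolute table for the
off-diagonal entry of the term matrix, valid for all `Δ ∈ [a, b]` — and three checks on the head sums.
The diagonal / off-diagonal entries are products of a two-weight evaluation `T(c, d; s)[𝒫_{Δ+n, j}]`
(`O2ChargedSectorsTail`) with the Dolan–Osborn weights `ρ₊(Δ) = ρ((Δ_t−Δ_s)/2)`, `ρ_s(Δ) = ρ((Δ_φ−Δ_s)/2)`,
`ρ_t(Δ) = ρ((Δ_t−Δ_φ)/2)` of the aligned mixed blocks [DolanOsborn2004, eq. (3.11)], which vary with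
`Δ` across the cell AND with the external dimensions.

This file supplies the tables in CLOSED FORM, uniformly on a box `lo ≤ D ≤ hi` of external dimensions
(`O2DimBox.InDimBox`; the point case is the degenerate box):

1. **Weight enclosures on (box) × (cell)** — `rhoPlus2pIv`, `rhoS1Iv`, `rhoT1Iv`: the cell enclosure
   `ConformalBootstrap3D.doPochRatioIv` of `ρ(a)(Δ)` over `Δ ∈ [E₁, E₂]` and the parameter interval of
   `a` induced by the box (`rhoPlus2p_mem_Icc`, `rhoS1_mem_Icc`, `rhoT1_mem_Icc`; the parameter
   intervals of `(Δ_t−Δ_s)/2`, `(Δ_t−Δ_φ)/2` and the shifted cell are `O2LightDimBox.cParam2m_mem`,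
   `cParam3_mem`, `add_mem_Icc_shift'`, reused).
2. **Closed-form tables** — `tabP2p`, `tabV2p`, `tabW2p` (sector `2⁺`) and `tabU1`, `tabV1`, `tabW1`
   (sector `1`): corner numbers `cornerBound₂` at the exponent intervals of the box (`O2DimBox`) combined
   with the weight enclosures by the interval product / square (`ivMulLo/Hi`, `sqLower/Upper`), with their
   validity on (box) × (cell) (`tabP2p_le`, `tabV2p_le`, `abs_le_tabW2p`, `tabU1_le`, `tabV1_le`,
   `abs_le_tabW1`).
3. **The light-row rules with closed-form tables** — `pos2p_on_dbox_cell`, `pos1_on_dbox_cell`: the three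
   head checks on the closed-form tables + termwise nonnegativity of the tail at every `D` of the box ⇒
   `Pos2p` / `Pos1` at every `D` of the box and every `Δ ∈ [a, b)`; and the point corollaries
   `pos2p_on_cell_Ico_of_corners`, `pos1_on_cell_Ico_of_corners` (box `lo = hi = D`).

NON-CLAIMS.  Soundness lemmas only: no table is evaluated here, no certificate is checked, and nothing is
asserted about the O(2) model.  Which cells, boxes and index sets `S` a reader uses is its business.
-/

noncomputable section

namespace Literature.MathematicalPhysics.QuantumFieldTheory.O2ChargedLightDimBox

open Set Finset Matrix
open Literature.MathematicalPhysics.QuantumFieldTheory.ConformalBootstrap3D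
open O2ThreeScalarCrossing O2ThreeScalarSystem O2OPEScanBridge O2ScanObligations
open O2NeutralSectorsTermwise O2ChargedSectorsTermwise O2ChargeTwoEvenTermwise O2ChargeOneTermwise
open O2NeutralSectorsCells O2ChargedSectorsCells O2ChargedSectorsTail O2ChargedSectorsRules O2DimBox
open O2ChargedDimBox
open O2LightDimBox (cParam3_mem cParam2m_mem add_mem_Icc_shift')

/-- `lo ≤ x ≤ hi ⇒ |x| ≤ max (−lo) hi` (private helper). [folklore] -/
private theorem abs_le_max_of_mem' {x lo hi : ℝ} (h1 : lo ≤ x) (h2 : x ≤ hi) :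
    |x| ≤ max (-lo) hi := by
  rw [abs_le]
  exact ⟨by linarith [le_max_left (-lo) hi], h2.trans (le_max_right _ _)⟩

/-- A cell strictly above the unitarity bound has `0 < a + ℓ` (the hypothesis of the weight enclosure).
[cite: DolanOsborn2004, §3 eq. (3.11)] -/
theorem add_pos_of_unitarityBound3D_lt {ℓ : ℕ} {a : ℝ} (ha : unitarityBound3D ℓ < a) :
    0 < a + ℓ := by
  have h := natCast_add_half_le_unitarityBound3D ℓ
  have : (0 : ℝ) ≤ ℓ := Nat.cast_nonneg ℓ
  linarith

/-! ## 0. The degenerate box -/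

/-- The degenerate box `lo = hi = D` contains `D`. [cite: ChesterEtAl2020, §3.3 (scanning over external dimensions)] -/
theorem inDimBox_self (D : Dims) : InDimBox D D D :=
  ⟨⟨le_rfl, le_rfl⟩, ⟨le_rfl, le_rfl⟩, ⟨le_rfl, le_rfl⟩⟩

/-! ## 1. The Dolan–Osborn weights on (box of external dimensions) × (cell) -/

/-- The parameter `(Δ_φ − Δ_s)/2` of `ρ_s` on a box. [cite: DolanOsborn2004, §3 eq. (3.11)]
[cite: ChesterEtAl2020, §3.3 (scanning over external dimensions)] -/
theorem aS_mem_Icc {lo hi D : Dims} (h : InDimBox lo hi D) :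
    (lo.Δφ - hi.Δs) / 2 ≤ (D.Δφ - D.Δs) / 2 ∧ (D.Δφ - D.Δs) / 2 ≤ (hi.Δφ - lo.Δs) / 2 := by
  obtain ⟨⟨hs1, hs2⟩, ⟨hp1, hp2⟩, -⟩ := h
  constructor <;> linarith

/-- Enclosure table of `ρ₊(Δ; ℓ, n, j)` on (box) × (cell `[E₁, E₂]`), a pair `(lo, hi)`.
[cite: DolanOsborn2004, §3 eq. (3.11)] [cite: Moore1979, §2.2 eqs. (2.18)–(2.19)] -/
def rhoPlus2pIv (lo hi : Dims) (E₁ E₂ : ℝ) (ℓ n j : ℕ) : ℝ × ℝ :=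
  doPochRatioIv ((lo.Δt - hi.Δs) / 2) ((hi.Δt - lo.Δs) / 2) E₁ E₂ ℓ n j

/-- Enclosure table of `ρ_s(Δ; ℓ, n, j)` on (box) × (cell). [cite: DolanOsborn2004, §3 eq. (3.11)]
[cite: Moore1979, §2.2 eqs. (2.18)–(2.19)] -/
def rhoS1Iv (lo hi : Dims) (E₁ E₂ : ℝ) (ℓ n j : ℕ) : ℝ × ℝ :=
  doPochRatioIv ((lo.Δφ - hi.Δs) / 2) ((hi.Δφ - lo.Δs) / 2) E₁ E₂ ℓ n j

/-- Enclosure table of `ρ_t(Δ; ℓ, n, j)` on (box) × (cell). [cite: DolanOsborn2004, §3 eq. (3.11)]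
[cite: Moore1979, §2.2 eqs. (2.18)–(2.19)] -/
def rhoT1Iv (lo hi : Dims) (E₁ E₂ : ℝ) (ℓ n j : ℕ) : ℝ × ℝ :=
  doPochRatioIv ((lo.Δt - hi.Δφ) / 2) ((hi.Δt - lo.Δφ) / 2) E₁ E₂ ℓ n j

/-- The separation hypothesis of the weight enclosure on a cell `[E₁, E₂]` at level `(ℓ, n, j)`: no factor
`(Δ−ℓ−1)/2 + i`, `i < n'`, changes sign on the cell (decidable on the reader's side; automatic above the
line `Δ = ℓ + 1`, `ConformalBootstrap3D.sep_of_lt`). [cite: DolanOsborn2004, §3 eq. (3.11)] -/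
def CellSep (E₁ E₂ : ℝ) (ℓ n j : ℕ) : Prop :=
  ∀ i : ℕ, i < doIndexN ℓ n j → 0 < (E₁ - ℓ - 1) / 2 + i ∨ (E₂ - ℓ - 1) / 2 + i < 0

/-- Above the line `Δ = ℓ + 1` the separation hypothesis holds. [cite: DolanOsborn2004, §3 eq. (3.11)] -/
theorem cellSep_of_lt {E₁ E₂ : ℝ} {ℓ : ℕ} (hE : (ℓ : ℝ) + 1 < E₁) (n j : ℕ) : CellSep E₁ E₂ ℓ n j :=
  sep_of_lt (E₂ := E₂) hE _

/-- **`ρ₊` on (box) × (cell)**: `ρ₊(D; Δ; ℓ, n, j) ∈ rhoPlus2pIv lo hi E₁ E₂ ℓ n j` for `lo ≤ D ≤ hi`,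
`Δ ∈ [E₁, E₂]`, `0 < E₁ + ℓ`, under the separation hypothesis. [cite: DolanOsborn2004, §3 eq. (3.11)]
[cite: Moore1979, §2.2 eqs. (2.18)–(2.19)] -/
theorem rhoPlus2p_mem_Icc {lo hi D : Dims} (hD : InDimBox lo hi D) {E₁ E₂ Δ : ℝ} {ℓ n j : ℕ}
    (hE : 0 < E₁ + ℓ) (hΔ : Δ ∈ Icc E₁ E₂) (hsep : CellSep E₁ E₂ ℓ n j) :
    rhoPlus2p D Δ ℓ n j ∈
      Icc (rhoPlus2pIv lo hi E₁ E₂ ℓ n j).1 (rhoPlus2pIv lo hi E₁ E₂ ℓ n j).2 := by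
  have ha := cParam2m_mem hD
  simpa only [rhoPlus2p, rhoPlus2pIv] using doPochRatio_mem_Icc_cell hE hΔ.1 hΔ.2 ha.1 ha.2 hsep

/-- **`ρ_s` on (box) × (cell).** [cite: DolanOsborn2004, §3 eq. (3.11)] [cite: Moore1979, §2.2 eqs. (2.18)–(2.19)] -/
theorem rhoS1_mem_Icc {lo hi D : Dims} (hD : InDimBox lo hi D) {E₁ E₂ Δ : ℝ} {ℓ n j : ℕ}
    (hE : 0 < E₁ + ℓ) (hΔ : Δ ∈ Icc E₁ E₂) (hsep : CellSep E₁ E₂ ℓ n j) :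
    rhoS1 D Δ ℓ n j ∈ Icc (rhoS1Iv lo hi E₁ E₂ ℓ n j).1 (rhoS1Iv lo hi E₁ E₂ ℓ n j).2 := by
  have ha := aS_mem_Icc hD
  simpa only [rhoS1, rhoS1Iv] using doPochRatio_mem_Icc_cell hE hΔ.1 hΔ.2 ha.1 ha.2 hsep

/-- **`ρ_t` on (box) × (cell).** [cite: DolanOsborn2004, §3 eq. (3.11)] [cite: Moore1979, §2.2 eqs. (2.18)–(2.19)] -/
theorem rhoT1_mem_Icc {lo hi D : Dims} (hD : InDimBox lo hi D) {E₁ E₂ Δ : ℝ} {ℓ n j : ℕ}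
    (hE : 0 < E₁ + ℓ) (hΔ : Δ ∈ Icc E₁ E₂) (hsep : CellSep E₁ E₂ ℓ n j) :
    rhoT1 D Δ ℓ n j ∈ Icc (rhoT1Iv lo hi E₁ E₂ ℓ n j).1 (rhoT1Iv lo hi E₁ E₂ ℓ n j).2 := by
  have ha := cParam3_mem hD
  simpa only [rhoT1, rhoT1Iv] using doPochRatio_mem_Icc_cell hE hΔ.1 hΔ.2 ha.1 ha.2 hsep

/-! ## 2. Closed-form tables of the sector `2⁺` on (box) × (cell) -/

/-- Lower table of the `P`-entry: `tabP2p q = cb(c_P, d_P; j, [a+n, b+n], [lo.Δφ, hi.Δφ])`, `q = (n, j)`.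
[cite: HogervorstRychkov2013, §3 eq. (3.6)] [cite: ChesterEtAl2020, §3.3 (scanning over external dimensions)] -/
def tabP2p (F : ScanFunctional) (lo hi : Dims) (a b : ℝ) (q : ℕ × ℕ) : ℝ :=
  cornerBound₂ (cwP F) (dwP F) F.z F.zb q.2 (a + q.1) (b + q.1) (lo.expo .φφφφ) (hi.expo .φφφφ)

/-- Lower table of the `ρ₊² 𝔇₂₋`-entry: interval product of the square enclosure of `ρ₊` with the
two-sided corner enclosure of `𝔇₂₋`. [cite: HogervorstRychkov2013, §3 eqs. (3.6), (3.9)]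
[cite: DolanOsborn2004, §3 eq. (3.11)] [cite: Moore1979, §2.2 eqs. (2.18)–(2.19)] -/
def tabV2p (F : ScanFunctional) (lo hi : Dims) (a b : ℝ) (ℓ : ℕ) (q : ℕ × ℕ) : ℝ :=
  ivMulLo (sqLower (rhoPlus2pIv lo hi a b ℓ q.1 q.2).1 (rhoPlus2pIv lo hi a b ℓ q.1 q.2).2)
    (sqUpper (rhoPlus2pIv lo hi a b ℓ q.1 q.2).1 (rhoPlus2pIv lo hi a b ℓ q.1 q.2).2)
    (cornerBound₂ (cWeight2m F) (dWeight2m F) F.z F.zb q.2 (a + q.1) (b + q.1) (lo.expo .stts)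
      (hi.expo .stts))
    (-cornerBound₂ (-cWeight2m F) (-dWeight2m F) F.z F.zb q.2 (a + q.1) (b + q.1) (lo.expo .stts)
      (hi.expo .stts))

/-- Absolute table of the `ρ₊ Q♮`-entry: the larger modulus of the interval product of the enclosure of
`ρ₊` with the two-sided corner enclosure of `Q♮`. [cite: HogervorstRychkov2013, §3 eqs. (3.6), (3.9)]
[cite: DolanOsborn2004, §3 eq. (3.11)] [cite: Moore1979, §2.2 eqs. (2.18)–(2.19)] -/
def tabW2p (F : ScanFunctional) (lo hi : Dims) (a b : ℝ) (ℓ : ℕ) (q : ℕ × ℕ) : ℝ :=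
  max (-ivMulLo (rhoPlus2pIv lo hi a b ℓ q.1 q.2).1 (rhoPlus2pIv lo hi a b ℓ q.1 q.2).2
      (cornerBound₂ (cwQ F) (dwQ F) F.z F.zb q.2 (a + q.1) (b + q.1) (expoQ lo) (expoQ hi))
      (-cornerBound₂ (-cwQ F) (-dwQ F) F.z F.zb q.2 (a + q.1) (b + q.1) (expoQ lo) (expoQ hi)))
    (ivMulHi (rhoPlus2pIv lo hi a b ℓ q.1 q.2).1 (rhoPlus2pIv lo hi a b ℓ q.1 q.2).2
      (cornerBound₂ (cwQ F) (dwQ F) F.z F.zb q.2 (a + q.1) (b + q.1) (expoQ lo) (expoQ hi))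
      (-cornerBound₂ (-cwQ F) (-dwQ F) F.z F.zb q.2 (a + q.1) (b + q.1) (expoQ lo) (expoQ hi)))

/-- **Validity of `tabP2p`** on (box) × (cell). [cite: HogervorstRychkov2013, §3 eq. (3.6)]
[cite: ChesterEtAl2020, §3.3 (scanning over external dimensions)] -/
theorem tabP2p_le (F : ScanFunctional) {lo hi D : Dims} (hD : InDimBox lo hi D) {a b : ℝ}
    (q : ℕ × ℕ) {Δ : ℝ} (hΔ : Δ ∈ Icc a b) :
    tabP2p F lo hi a b q ≤ pForm2p F D (zMono (Δ + (q.1 : ℝ)) q.2) := by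
  rw [pForm2p_eq_twoWeightEval]
  exact (twoWeightEval_mem_Icc_corner_expo F (cwP F) (dwP F) q.2 (add_mem_Icc_shift' hΔ q.1) hD .φφφφ).1

/-- **Validity of `tabV2p`** on (box) × (cell) (under `0 < a + ℓ` and the separation hypothesis at `q`).
[cite: HogervorstRychkov2013, §3 eqs. (3.6), (3.9)] [cite: DolanOsborn2004, §3 eq. (3.11)]
[cite: Moore1979, §2.2 eqs. (2.18)–(2.19)] -/
theorem tabV2p_le (F : ScanFunctional) {lo hi D : Dims} (hD : InDimBox lo hi D) {a b : ℝ} {ℓ : ℕ}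
    (ha : 0 < a + ℓ) (q : ℕ × ℕ) (hsep : CellSep a b ℓ q.1 q.2) {Δ : ℝ} (hΔ : Δ ∈ Icc a b) :
    tabV2p F lo hi a b ℓ q ≤ rhoPlus2p D Δ ℓ q.1 q.2 ^ 2 * dom2mTerm F D (Δ + (q.1 : ℝ)) q.2 := by
  have hρ := doPochRatio_sq_mem_Icc (rhoPlus2p_mem_Icc hD ha hΔ hsep)
  have hT := twoWeightEval_mem_Icc_corner_expo F (cWeight2m F) (dWeight2m F) q.2
    (add_mem_Icc_shift' hΔ q.1) hD .stts
  rw [← dom2mTerm_eq_twoWeightEval] at hT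
  exact (mul_mem_Icc_ivMul hρ ⟨hT.1, hT.2⟩).1

/-- **Validity of `tabW2p`** on (box) × (cell) (same side conditions).
[cite: HogervorstRychkov2013, §3 eqs. (3.6), (3.9)] [cite: DolanOsborn2004, §3 eq. (3.11)]
[cite: Moore1979, §2.2 eqs. (2.18)–(2.19)] -/
theorem abs_le_tabW2p (F : ScanFunctional) {lo hi D : Dims} (hD : InDimBox lo hi D) {a b : ℝ} {ℓ : ℕ}
    (ha : 0 < a + ℓ) (q : ℕ × ℕ) (hsep : CellSep a b ℓ q.1 q.2) {Δ : ℝ} (hΔ : Δ ∈ Icc a b) :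
    |rhoPlus2p D Δ ℓ q.1 q.2 * qForm2pA F D (zMono (Δ + (q.1 : ℝ)) q.2)| ≤ tabW2p F lo hi a b ℓ q := by
  have hρ := rhoPlus2p_mem_Icc hD ha hΔ hsep
  have hQ := twoWeightEval_mem_Icc_corner₂ F (cwQ F) (dwQ F) q.2 (add_mem_Icc_shift' hΔ q.1)
    (expoQ_mem_Icc hD)
  rw [← qForm2pA_eq_twoWeightEval] at hQ
  have h := mul_mem_Icc_ivMul hρ ⟨hQ.1, hQ.2⟩
  exact abs_le_max_of_mem' h.1 h.2

/-! ## 3. The `2⁺` light rows with closed-form tables -/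

/-- **`2⁺` LIGHT ROWS ON A BOX OF EXTERNAL DIMENSIONS, closed-form tables.**  Cell `[a, b]` strictly above
the unitarity bound (avoiding `Δ = 1` when `ℓ = 0`), the separation hypothesis at every head index, the
three head checks `X ≥ 0`, `Y ≥ 0`, `Z² ≤ 4XY` on the head sums of the closed-form tables
`tabP2p, tabV2p, tabW2p`, and the tail terms outside `S` nonnegative at every `D` of the box (e.g. by the
kernel test on the box, `O2ChargedDimBox.kernelTest2p_on_dbox`) ⇒ `Pos2p` at EVERY `D` with `lo ≤ D ≤ hi`
and every `Δ ∈ [a, b)`. [cite: KosPolandSimmonsduffin2014, §3.3 eq. (3.16), §4 eqs. (4.2)–(4.3)]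
[cite: HogervorstRychkov2013, §3 eqs. (3.6), (3.9)] [cite: DolanOsborn2004, §3 eq. (3.11)]
[cite: ChesterEtAl2020, §3.3 (scanning over external dimensions)] -/
theorem pos2p_on_dbox_cell (F : ScanFunctional) {lo hi : Dims} {ℓ : ℕ} {a b : ℝ}
    (ha : unitarityBound3D ℓ < a) (h1 : ℓ = 0 → b ≤ 1 ∨ 1 < a) (S : Finset (ℕ × ℕ))
    (hsep : ∀ q ∈ S, CellSep a b ℓ q.1 q.2)
    (hX : 0 ≤ headCellSumI ℓ a b S (tabP2p F lo hi a b))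
    (hY : 0 ≤ headCellSumI ℓ a b S (tabV2p F lo hi a b ℓ))
    (hdet : headAbsSumI ℓ a b S (tabW2p F lo hi a b ℓ) ^ 2 ≤
      4 * headCellSumI ℓ a b S (tabP2p F lo hi a b) * headCellSumI ℓ a b S (tabV2p F lo hi a b ℓ))
    (htail : ∀ D, InDimBox lo hi D → ∀ q : ℕ × ℕ, q ∉ S → InDescendantRange ℓ q.1 q.2 →
      ∀ Δ ∈ Icc a b, ∀ b' z : ℝ, 0 ≤ dom2pTermForm F D Δ ℓ q.1 q.2 b' z) :
    ∀ D, InDimBox lo hi D → ∀ Δ ∈ Ico a b, Pos2p F.toFunctional D Δ ℓ := fun D hD =>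
  pos2p_on_cell_Ico F D ha h1 S (tabP2p F lo hi a b) (tabV2p F lo hi a b ℓ) (tabW2p F lo hi a b ℓ)
    (fun q _ _ hΔ => tabP2p_le F hD q hΔ)
    (fun q hq _ hΔ => tabV2p_le F hD (add_pos_of_unitarityBound3D_lt ha) q (hsep q hq) hΔ)
    (fun q hq _ hΔ => abs_le_tabW2p F hD (add_pos_of_unitarityBound3D_lt ha) q (hsep q hq) hΔ)
    hX hY hdet (htail D hD)

/-- **`2⁺` light rows at a POINT of external dimensions, closed-form tables** (the degenerate box
`lo = hi = D`). [cite: KosPolandSimmonsduffin2014, §3.3 eq. (3.16), §4 eqs. (4.2)–(4.3)]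
[cite: HogervorstRychkov2013, §3 eqs. (3.6), (3.9)] [cite: DolanOsborn2004, §3 eq. (3.11)] -/
theorem pos2p_on_cell_Ico_of_corners (F : ScanFunctional) (D : Dims) {ℓ : ℕ} {a b : ℝ}
    (ha : unitarityBound3D ℓ < a) (h1 : ℓ = 0 → b ≤ 1 ∨ 1 < a) (S : Finset (ℕ × ℕ))
    (hsep : ∀ q ∈ S, CellSep a b ℓ q.1 q.2)
    (hX : 0 ≤ headCellSumI ℓ a b S (tabP2p F D D a b))
    (hY : 0 ≤ headCellSumI ℓ a b S (tabV2p F D D a b ℓ))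
    (hdet : headAbsSumI ℓ a b S (tabW2p F D D a b ℓ) ^ 2 ≤
      4 * headCellSumI ℓ a b S (tabP2p F D D a b) * headCellSumI ℓ a b S (tabV2p F D D a b ℓ))
    (htail : ∀ q : ℕ × ℕ, q ∉ S → InDescendantRange ℓ q.1 q.2 →
      ∀ Δ ∈ Icc a b, ∀ b' z : ℝ, 0 ≤ dom2pTermForm F D Δ ℓ q.1 q.2 b' z) :
    ∀ Δ ∈ Ico a b, Pos2p F.toFunctional D Δ ℓ :=
  pos2p_on_cell_Ico F D ha h1 S (tabP2p F D D a b) (tabV2p F D D a b ℓ) (tabW2p F D D a b ℓ)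
    (fun q _ _ hΔ => tabP2p_le F (inDimBox_self D) q hΔ)
    (fun q hq _ hΔ => tabV2p_le F (inDimBox_self D) (add_pos_of_unitarityBound3D_lt ha) q
      (hsep q hq) hΔ)
    (fun q hq _ hΔ => abs_le_tabW2p F (inDimBox_self D) (add_pos_of_unitarityBound3D_lt ha) q
      (hsep q hq) hΔ)
    hX hY hdet htail

/-! ## 4. Closed-form tables of the sector `1` on (box) × (cell) -/

/-- Lower table of the `ρ_s² 𝔇ˣκ`-entry. [cite: HogervorstRychkov2013, §3 eqs. (3.6), (3.9)]
[cite: DolanOsborn2004, §3 eq. (3.11)] [cite: Moore1979, §2.2 eqs. (2.18)–(2.19)] -/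
def tabU1 (F : ScanFunctional) (κ : ℝ) (lo hi : Dims) (a b : ℝ) (ℓ : ℕ) (q : ℕ × ℕ) : ℝ :=
  ivMulLo (sqLower (rhoS1Iv lo hi a b ℓ q.1 q.2).1 (rhoS1Iv lo hi a b ℓ q.1 q.2).2)
    (sqUpper (rhoS1Iv lo hi a b ℓ q.1 q.2).1 (rhoS1Iv lo hi a b ℓ q.1 q.2).2)
    (cornerBound₂ (cWeightX1 F κ) (dWeightX1 F κ) F.z F.zb q.2 (a + q.1) (b + q.1) (lo.expo .sφφs)
      (hi.expo .sφφs))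
    (-cornerBound₂ (-cWeightX1 F κ) (-dWeightX1 F κ) F.z F.zb q.2 (a + q.1) (b + q.1) (lo.expo .sφφs)
      (hi.expo .sφφs))

/-- Lower table of the `ρ_t² 𝔇ʸκ`-entry. [cite: HogervorstRychkov2013, §3 eqs. (3.6), (3.9)]
[cite: DolanOsborn2004, §3 eq. (3.11)] [cite: Moore1979, §2.2 eqs. (2.18)–(2.19)] -/
def tabV1 (F : ScanFunctional) (κ : ℝ) (lo hi : Dims) (a b : ℝ) (ℓ : ℕ) (q : ℕ × ℕ) : ℝ :=
  ivMulLo (sqLower (rhoT1Iv lo hi a b ℓ q.1 q.2).1 (rhoT1Iv lo hi a b ℓ q.1 q.2).2)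
    (sqUpper (rhoT1Iv lo hi a b ℓ q.1 q.2).1 (rhoT1Iv lo hi a b ℓ q.1 q.2).2)
    (cornerBound₂ (cWeightY1 F κ) (dWeightY1 F κ) F.z F.zb q.2 (a + q.1) (b + q.1) (lo.expo .φttφ)
      (hi.expo .φttφ))
    (-cornerBound₂ (-cWeightY1 F κ) (-dWeightY1 F κ) F.z F.zb q.2 (a + q.1) (b + q.1) (lo.expo .φttφ)
      (hi.expo .φttφ))

/-- Enclosure of the product `ρ_s ρ_t` on (box) × (cell): interval product of the two weight tables, a
pair `(lo, hi)`. [cite: DolanOsborn2004, §3 eq. (3.11)] [cite: Moore1979, §2.2 eqs. (2.18)–(2.19)] -/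
def rhoST1Iv (lo hi : Dims) (a b : ℝ) (ℓ n j : ℕ) : ℝ × ℝ :=
  (ivMulLo (rhoS1Iv lo hi a b ℓ n j).1 (rhoS1Iv lo hi a b ℓ n j).2 (rhoT1Iv lo hi a b ℓ n j).1
      (rhoT1Iv lo hi a b ℓ n j).2,
    ivMulHi (rhoS1Iv lo hi a b ℓ n j).1 (rhoS1Iv lo hi a b ℓ n j).2 (rhoT1Iv lo hi a b ℓ n j).1
      (rhoT1Iv lo hi a b ℓ n j).2)

/-- Absolute table of the `ρ_s ρ_t W¹♮`-entry. [cite: HogervorstRychkov2013, §3 eqs. (3.6), (3.9)]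
[cite: DolanOsborn2004, §3 eq. (3.11)] [cite: Moore1979, §2.2 eqs. (2.18)–(2.19)] -/
def tabW1 (F : ScanFunctional) (lo hi : Dims) (a b : ℝ) (ℓ : ℕ) (q : ℕ × ℕ) : ℝ :=
  max (-ivMulLo (rhoST1Iv lo hi a b ℓ q.1 q.2).1 (rhoST1Iv lo hi a b ℓ q.1 q.2).2
      (cornerBound₂ (cwW1 F) (cwW1 F) F.z F.zb q.2 (a + q.1) (b + q.1) (expoW1 lo) (expoW1 hi))
      (-cornerBound₂ (-cwW1 F) (-cwW1 F) F.z F.zb q.2 (a + q.1) (b + q.1) (expoW1 lo) (expoW1 hi)))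
    (ivMulHi (rhoST1Iv lo hi a b ℓ q.1 q.2).1 (rhoST1Iv lo hi a b ℓ q.1 q.2).2
      (cornerBound₂ (cwW1 F) (cwW1 F) F.z F.zb q.2 (a + q.1) (b + q.1) (expoW1 lo) (expoW1 hi))
      (-cornerBound₂ (-cwW1 F) (-cwW1 F) F.z F.zb q.2 (a + q.1) (b + q.1) (expoW1 lo) (expoW1 hi)))

/-- **Validity of `tabU1`** on (box) × (cell). [cite: HogervorstRychkov2013, §3 eqs. (3.6), (3.9)]
[cite: DolanOsborn2004, §3 eq. (3.11)] [cite: Moore1979, §2.2 eqs. (2.18)–(2.19)] -/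
theorem tabU1_le (F : ScanFunctional) (κ : ℝ) {lo hi D : Dims} (hD : InDimBox lo hi D) {a b : ℝ}
    {ℓ : ℕ} (ha : 0 < a + ℓ) (q : ℕ × ℕ) (hsep : CellSep a b ℓ q.1 q.2) {Δ : ℝ} (hΔ : Δ ∈ Icc a b) :
    tabU1 F κ lo hi a b ℓ q ≤ rhoS1 D Δ ℓ q.1 q.2 ^ 2 * domX1Term F D κ (Δ + (q.1 : ℝ)) q.2 := by
  have hρ := doPochRatio_sq_mem_Icc (rhoS1_mem_Icc hD ha hΔ hsep)
  have hT := twoWeightEval_mem_Icc_corner_expo F (cWeightX1 F κ) (dWeightX1 F κ) q.2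
    (add_mem_Icc_shift' hΔ q.1) hD .sφφs
  rw [← domX1Term_eq_twoWeightEval] at hT
  exact (mul_mem_Icc_ivMul hρ ⟨hT.1, hT.2⟩).1

/-- **Validity of `tabV1`** on (box) × (cell). [cite: HogervorstRychkov2013, §3 eqs. (3.6), (3.9)]
[cite: DolanOsborn2004, §3 eq. (3.11)] [cite: Moore1979, §2.2 eqs. (2.18)–(2.19)] -/
theorem tabV1_le (F : ScanFunctional) (κ : ℝ) {lo hi D : Dims} (hD : InDimBox lo hi D) {a b : ℝ}
    {ℓ : ℕ} (ha : 0 < a + ℓ) (q : ℕ × ℕ) (hsep : CellSep a b ℓ q.1 q.2) {Δ : ℝ} (hΔ : Δ ∈ Icc a b) :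
    tabV1 F κ lo hi a b ℓ q ≤ rhoT1 D Δ ℓ q.1 q.2 ^ 2 * domY1Term F D κ (Δ + (q.1 : ℝ)) q.2 := by
  have hρ := doPochRatio_sq_mem_Icc (rhoT1_mem_Icc hD ha hΔ hsep)
  have hT := twoWeightEval_mem_Icc_corner_expo F (cWeightY1 F κ) (dWeightY1 F κ) q.2
    (add_mem_Icc_shift' hΔ q.1) hD .φttφ
  rw [← domY1Term_eq_twoWeightEval] at hT
  exact (mul_mem_Icc_ivMul hρ ⟨hT.1, hT.2⟩).1

/-- **Validity of `tabW1`** on (box) × (cell). [cite: HogervorstRychkov2013, §3 eqs. (3.6), (3.9)]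
[cite: DolanOsborn2004, §3 eq. (3.11)] [cite: Moore1979, §2.2 eqs. (2.18)–(2.19)] -/
theorem abs_le_tabW1 (F : ScanFunctional) {lo hi D : Dims} (hD : InDimBox lo hi D) {a b : ℝ} {ℓ : ℕ}
    (ha : 0 < a + ℓ) (q : ℕ × ℕ) (hsep : CellSep a b ℓ q.1 q.2) {Δ : ℝ} (hΔ : Δ ∈ Icc a b) :
    |rhoS1 D Δ ℓ q.1 q.2 * rhoT1 D Δ ℓ q.1 q.2 * w1Form1A F D (zMono (Δ + (q.1 : ℝ)) q.2)| ≤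
      tabW1 F lo hi a b ℓ q := by
  have hρ : rhoS1 D Δ ℓ q.1 q.2 * rhoT1 D Δ ℓ q.1 q.2 ∈
      Icc (rhoST1Iv lo hi a b ℓ q.1 q.2).1 (rhoST1Iv lo hi a b ℓ q.1 q.2).2 :=
    mul_mem_Icc_ivMul (rhoS1_mem_Icc hD ha hΔ hsep) (rhoT1_mem_Icc hD ha hΔ hsep)
  have hW := twoWeightEval_mem_Icc_corner₂ F (cwW1 F) (cwW1 F) q.2 (add_mem_Icc_shift' hΔ q.1)
    (expoW1_mem_Icc hD)
  rw [← w1Form1A_eq_twoWeightEval] at hW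
  have h := mul_mem_Icc_ivMul hρ ⟨hW.1, hW.2⟩
  exact abs_le_max_of_mem' h.1 h.2

/-! ## 5. The sector-`1` light rows with closed-form tables -/

/-- **SECTOR-`1` LIGHT ROWS ON A BOX OF EXTERNAL DIMENSIONS, closed-form tables** (certificate constant
`κ > 0`): as `pos2p_on_dbox_cell` with the tables `tabU1, tabV1, tabW1`.
[cite: KosPolandSimmonsduffin2014, §3.3 eq. (3.16), §4 eqs. (4.2)–(4.3)]
[cite: HogervorstRychkov2013, §3 eqs. (3.6), (3.9)] [cite: DolanOsborn2004, §3 eq. (3.11)]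
[cite: PappadopuloRychkovEspinRattazzi2012, §5] [cite: ChesterEtAl2020, §3.3 (scanning over external dimensions)] -/
theorem pos1_on_dbox_cell (F : ScanFunctional) {lo hi : Dims} {κ : ℝ} (hκ : 0 < κ) {ℓ : ℕ} {a b : ℝ}
    (ha : unitarityBound3D ℓ < a) (h1 : ℓ = 0 → b ≤ 1 ∨ 1 < a) (S : Finset (ℕ × ℕ))
    (hsep : ∀ q ∈ S, CellSep a b ℓ q.1 q.2)
    (hX : 0 ≤ headCellSumI ℓ a b S (tabU1 F κ lo hi a b ℓ))
    (hY : 0 ≤ headCellSumI ℓ a b S (tabV1 F κ lo hi a b ℓ))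
    (hdet : headAbsSumI ℓ a b S (tabW1 F lo hi a b ℓ) ^ 2 ≤
      4 * headCellSumI ℓ a b S (tabU1 F κ lo hi a b ℓ) * headCellSumI ℓ a b S (tabV1 F κ lo hi a b ℓ))
    (htail : ∀ D, InDimBox lo hi D → ∀ q : ℕ × ℕ, q ∉ S → InDescendantRange ℓ q.1 q.2 →
      ∀ Δ ∈ Icc a b, ∀ x y : ℝ, 0 ≤ dom1TermForm F D κ Δ ℓ q.1 q.2 x y) :
    ∀ D, InDimBox lo hi D → ∀ Δ ∈ Ico a b, Pos1 F.toFunctional D Δ ℓ := fun D hD =>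
  pos1_on_cell_Ico F D hκ ha h1 S (tabU1 F κ lo hi a b ℓ) (tabV1 F κ lo hi a b ℓ) (tabW1 F lo hi a b ℓ)
    (fun q hq _ hΔ => tabU1_le F κ hD (add_pos_of_unitarityBound3D_lt ha) q (hsep q hq) hΔ)
    (fun q hq _ hΔ => tabV1_le F κ hD (add_pos_of_unitarityBound3D_lt ha) q (hsep q hq) hΔ)
    (fun q hq _ hΔ => abs_le_tabW1 F hD (add_pos_of_unitarityBound3D_lt ha) q (hsep q hq) hΔ)
    hX hY hdet (htail D hD)

/-- **Sector-`1` light rows at a POINT of external dimensions, closed-form tables** (degenerate box).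
[cite: KosPolandSimmonsduffin2014, §3.3 eq. (3.16), §4 eqs. (4.2)–(4.3)]
[cite: HogervorstRychkov2013, §3 eqs. (3.6), (3.9)] [cite: DolanOsborn2004, §3 eq. (3.11)] -/
theorem pos1_on_cell_Ico_of_corners (F : ScanFunctional) (D : Dims) {κ : ℝ} (hκ : 0 < κ) {ℓ : ℕ}
    {a b : ℝ} (ha : unitarityBound3D ℓ < a) (h1 : ℓ = 0 → b ≤ 1 ∨ 1 < a) (S : Finset (ℕ × ℕ))
    (hsep : ∀ q ∈ S, CellSep a b ℓ q.1 q.2)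
    (hX : 0 ≤ headCellSumI ℓ a b S (tabU1 F κ D D a b ℓ))
    (hY : 0 ≤ headCellSumI ℓ a b S (tabV1 F κ D D a b ℓ))
    (hdet : headAbsSumI ℓ a b S (tabW1 F D D a b ℓ) ^ 2 ≤
      4 * headCellSumI ℓ a b S (tabU1 F κ D D a b ℓ) * headCellSumI ℓ a b S (tabV1 F κ D D a b ℓ))
    (htail : ∀ q : ℕ × ℕ, q ∉ S → InDescendantRange ℓ q.1 q.2 →
      ∀ Δ ∈ Icc a b, ∀ x y : ℝ, 0 ≤ dom1TermForm F D κ Δ ℓ q.1 q.2 x y) :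
    ∀ Δ ∈ Ico a b, Pos1 F.toFunctional D Δ ℓ :=
  pos1_on_cell_Ico F D hκ ha h1 S (tabU1 F κ D D a b ℓ) (tabV1 F κ D D a b ℓ) (tabW1 F D D a b ℓ)
    (fun q hq _ hΔ => tabU1_le F κ (inDimBox_self D) (add_pos_of_unitarityBound3D_lt ha) q
      (hsep q hq) hΔ)
    (fun q hq _ hΔ => tabV1_le F κ (inDimBox_self D) (add_pos_of_unitarityBound3D_lt ha) q
      (hsep q hq) hΔ)
    (fun q hq _ hΔ => abs_le_tabW1 F (inDimBox_self D) (add_pos_of_unitarityBound3D_lt ha) q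
      (hsep q hq) hΔ)
    hX hY hdet htail

end Literature.MathematicalPhysics.QuantumFieldTheory.O2ChargedLightDimBox

end
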